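import Summits.ResolutionOfSingularities.ResolutionOfSingularities.Theorems.HilbertSamuelEliminationSigmaMaxModificationsCorridor3SigmaMenuTiers
import Summits.ResolutionOfSingularities.ResolutionOfSingularities.Theorems.HilbertSamuelEliminationSigmaMaxModificationsCorridor3SigmaMenuStratum
import HarnessLib

/-!
# [OURS · L1 W4.2] σ-LAYER — `Corridor3SigmaMenuSurfacePhase`: the (P1) tier `StrategyE.surfacePhase Ready prep` (SURFACES FIRST: blow up a READY
# 2-dimensional component of `X(ν)`, else play the PREP oracle's centre on it — (P1*) regularise-then-serve), policy-parametric in the readiness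
# predicate and the prep oracle; and the ASSEMBLY of record: the three-tier POLICY `StrategyE.policyOfRecord π₁ π₂ π₃ := π₁.hybrid (π₂.hybrid π₃)`
# whose hybrid over the CJS fallback `ofStageOracleE ω` is LITERALLY the shape `π.hybrid (ofStageOracleE ω)` of `HybridEliminationHyp3S`, with its
# stratum discipline, functionality, «steps only while non-empty» and scoped admissibility
# (res-L1-w42-plan-1 RULINGS v3.14-26 (GN), -27 (GQ), -29 (GV), -32 (HF) (3), WORD 14:14:25Z «o1: MenuTiers → `surfacePhase` assembly → (D1) instances»;
# CHAIN v3.20 §0s.3 (B) (P1*); crux chain w42 `SigmaMaxModifications` stmt-ResolutionOfSingularities-18506 / conjunct `SigmaMaxModificationsCorridor3`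
# stmt-ResolutionOfSingularities-19249; typer res-L1-type-o1 (OURS typer G4); `--supports stmt-…-19249 --as helper`, counted 0)

HONEST FRAMING. OURS design bookkeeping over this typer's `…SigmaMenuScheduler` (p533524), `…SigmaMenuTiers` (p538677), `…SigmaMenuStratum`
(p536950). The READINESS predicate (intended instance: `D̃` regular and n.c. with the boundary read on the regular carrier — res-type-067's
`…SigmaBoundaryOnSurface` p538136 / res-L1-w42-tri-2's restatement, res-L1-w42-plan-1's ruling pending) and the PREP oracle (PHASE S = the CJS dim-2
canonical centre of the singular surface component, F-72 truncated; PHASE B′ = the point steps at the non-n.c. locus) are PARAMETERS here — this file fixes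
the SHAPE of the (P1) tier and of the assembled policy, not their instances. NOTHING here is a statement of H. Hironaka's manuscript [Hironaka2017] nor of
Cossart–Jannsen–Saito [CossartJannsenSaito2020]; no named fact is introduced; AI-typed, AI review is weaker than expert review.

## Contents (namespace `…Theorems.SigmaMaxModificationsCorridor3.Sigma`)

* §1 `surfaceComponents W N ν` (the 2-dimensional irreducible components of `X(ν)`), `SurfaceReadiness`, `SurfacePrep`, **`surfaceProposal Ready prep :
  SiteProposal`** (a point `x` of a surface component `D` proposes: `Bl_D` — `C = menuCentre D`, `P' = none` — if `Ready … D`, else the prep centre for `D`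
  through `x`, `P' = none`), **`StrategyE.surfacePhase Ready prep := oldestFirst (surfaceProposal Ready prep) unitKey`** (any live surface site; functional
  by the fixed classical choice), `surfacePhase_isFunctional`, `surfacePhase_step_spec`, **`surfacePhase_isStratumDisciplined`** (hypotheses: ready
  components are regular as subschemes — readiness MEANS at least that —, prep centres are regular, through their point, inside `X(ν)`),
  `surfacePhase_exists_step_iff` (speaks iff some surface component carries a proposal).
* §2 **`StrategyE.policyOfRecord π₁ π₂ π₃ := π₁.hybrid (π₂.hybrid π₃)`** — so that `(policyOfRecord π₁ π₂ π₃).hybrid τ` is LITERALLY `π.hybrid τ`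
  (`HybridEliminationHyp3S`'s shape) and STEP-EQUIVALENT to `StrategyE.tiered π₁ π₂ π₃ τ` (`hybrid_assoc_step_iff`, `policyOfRecord_hybrid_step_iff_tiered`);
  `IsFunctional.policyOfRecord`, **`IsStratumDisciplined.policyOfRecord`** (three stratum-disciplined tiers ⇒ a stratum-disciplined policy — Plus
  discipline of a tier enters through `IsMenuDisciplined.toStratum`), `policyOfRecord_stepsOnlyWhileNonempty_hybrid_ofStageOracleE`,
  **`isAdmissibleStrategyOnE_policyOfRecord_hybrid`** (good scope, clause (a) + totality of the fallback ⇒ admissible), and the named sugar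
  `IsStratumDisciplined.tiered` / `isAdmissibleStrategyOnE_tiered_stratum` deferred from `…SigmaMenuTiers`.

VACUITY SELF-CHECK. Definitions + one-line consequences of landed lemmas; `surfacePhase` is non-trivial as soon as `X(ν)` has a surface component with a
proposal; the discipline/admissibility statements carry their geometric content in the named hypotheses (readiness ⇒ regular; prep centres regular ⊆ `X(ν)`),
which the (P1*) instance files discharge.
-/

noncomputable section

set_option linter.dupNamespace false -- mandated namespace of this single-conjunct summit

open CategoryTheory AlgebraicGeometry TopologicalSpace
open Summit.ResolutionOfSingularities.ResolutionOfSingularities.Theorems.CampaignW42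
open Literature.AlgebraicGeometry.Resolution Literature.RingTheory.HilbertSamuel

namespace Summit.ResolutionOfSingularities.ResolutionOfSingularities.Theorems.SigmaMaxModificationsCorridor3.Sigma

universe u

/-! ## §1. The (P1) tier: surfaces first -/

/-- [OURS · L1 W4.2] **THE SURFACE COMPONENTS OF `X(ν)`**: its irreducible components of (topological Krull) dimension `2` — on a threefold stage, the
surfaces inside the `ν`-stratum that (P1) serves first. NOT a statement of the manuscript. [folklore] -/
def surfaceComponents (W : Scheme.{u}) (N : ℕ) (ν : ℕ → ℕ) : Set (Set W) :=
  {D | D ∈ componentsIn (Scheme.hsStratum W N ν) ∧ topologicalKrullDim D = 2}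

/-- A surface component lies in the stratum. [folklore] -/
theorem subset_hsStratum_of_mem_surfaceComponents {W : Scheme.{u}} {N : ℕ} {ν : ℕ → ℕ} {D : Set W}
    (hD : D ∈ surfaceComponents W N ν) : D ⊆ Scheme.hsStratum W N ν :=
  componentsIn.subset hD.1

/-- [OURS · L1 W4.2] **A SURFACE READINESS PREDICATE**: «the surface `D` (a closed subset of the stage, with boundary `E`) may be blown up now»
(intended instance: `(menuCentre D).subscheme` regular and `D` n.c. with the boundary on the regular carrier — the end state of (P1*)). [folklore] -/
abbrev SurfaceReadiness : Type (u + 1) :=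
  ∀ (W : Scheme.{u}), Boundary W → ℕ → (ℕ → ℕ) → Closeds W → Prop

/-- [OURS · L1 W4.2] **A SURFACE PREP ORACLE**: «at the state, for the (not yet ready) surface `D`, the prep step blows up `C`» (intended instance:
PHASE S — the CJS dimension-2 canonical centre of `D`, F-72 truncated at «`D` regular» — then PHASE B′ — the points of the non-n.c. locus). [folklore] -/
abbrev SurfacePrep : Type (u + 1) :=
  ∀ (W : Scheme.{u}), IsLocallyNoetherian W → ℕ → (ℕ → ℕ) → Labelling W → Option (Pending W) → Boundary W → Closeds W →
    W.IdealSheafData → Prop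

section Surface

variable (Ready : SurfaceReadiness.{u}) (prep : SurfacePrep.{u})

/-- [OURS · L1 W4.2] **THE SURFACE PROPOSAL RELATION** ((P1) with (P1*)): a point `x` of a surface component `D` of `X(ν)` proposes — if `D` is READY —
the blow-up of `D` itself (`C = menuCentre D`, next cycle state `none`), and otherwise the PREP oracle's centre for `D`, provided it passes through `x`
(`P' = none`: designed steps run between CJS cycles, RULING (FW) β). NOT a statement of the manuscript. [folklore] -/
def surfaceProposal : SiteProposal.{u} :=
  fun W hW N ν L P E x C P' =>
    ∃ (D : Closeds W), (D : Set W) ∈ surfaceComponents W N ν ∧ x ∈ (D : Set W) ∧ P' = none ∧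
      ((Ready W E N ν D ∧ C = menuCentre D) ∨ (¬ Ready W E N ν D ∧ prep W hW N ν L P E D C ∧ x ∈ (C.support : Set W)))

/-- [OURS · L1 W4.2] The trivial site key (every live surface site is «oldest»: (P1) serves ANY surface component). [folklore] -/
def unitKey : SiteKey.{u} Unit :=
  fun _ _ _ _ _ _ _ _ => ()

/-- [OURS · L1 W4.2] **THE (P1) TIER — SURFACES FIRST**: oldest-first over the surface proposals with the trivial key, i.e. ONE surface proposal chosen
by the fixed classical choice whenever some surface component of `X(ν)` carries one; silent otherwise. Functional by construction. NOT a statement of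
the manuscript. [folklore] -/
def StrategyE.surfacePhase : StrategyE.{u} :=
  StrategyE.oldestFirst (surfaceProposal Ready prep) unitKey

variable {Ready prep} {N : ℕ} {ν : ℕ → ℕ}

/-- Unfolding (`rfl`). [folklore] -/
theorem StrategyE.surfacePhase_eq : StrategyE.surfacePhase Ready prep = StrategyE.oldestFirst (surfaceProposal Ready prep) unitKey :=
  rfl

/-- **The (P1) tier is FUNCTIONAL.** [folklore] -/
theorem StrategyE.surfacePhase_isFunctional (Ready : SurfaceReadiness.{u}) (prep : SurfacePrep.{u}) (N : ℕ) (ν : ℕ → ℕ) :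
    (StrategyE.surfacePhase Ready prep).IsFunctional N ν :=
  StrategyE.oldestFirst_isFunctional _ _ N ν

/-- **Every (P1) step is a surface proposal at a stratum point**: the blow-up of a READY surface component through the point, or a prep centre
through it for a non-ready one. [folklore] -/
theorem StrategyE.surfacePhase_step_spec {W : Scheme.{u}} {hW : IsLocallyNoetherian W} {L : Labelling W} {P : Option (Pending W)}
    {E : Boundary W} {C : W.IdealSheafData} {P' : Option (Pending (blowup C))}
    (hs : (StrategyE.surfacePhase Ready prep).step W hW N ν L P E C P') :
    ∃ (x : W) (D : Closeds W), x ∈ Scheme.hsStratum W N ν ∧ (D : Set W) ∈ surfaceComponents W N ν ∧ x ∈ (D : Set W) ∧ P' = none ∧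
      ((Ready W E N ν D ∧ C = menuCentre D) ∨ (¬ Ready W E N ν D ∧ prep W hW N ν L P E D C ∧ x ∈ (C.support : Set W))) := by
  obtain ⟨x, ⟨⟨hx, -⟩, -⟩, D, hD, hxD, hP', h⟩ := StrategyE.oldestFirst_step_spec hs
  exact ⟨x, D, hx, hD, hxD, hP', h⟩

/-- (P1) steps leave no CJS cycle pending: `P' = none`. [folklore] -/
theorem StrategyE.surfacePhase_step_pending_eq_none {W : Scheme.{u}} {hW : IsLocallyNoetherian W} {L : Labelling W} {P : Option (Pending W)}
    {E : Boundary W} {C : W.IdealSheafData} {P' : Option (Pending (blowup C))}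
    (hs : (StrategyE.surfacePhase Ready prep).step W hW N ν L P E C P') : P' = none := by
  obtain ⟨-, -, -, -, -, hP', -⟩ := StrategyE.surfacePhase_step_spec hs
  exact hP'

/-- **The (P1) tier speaks iff some surface component of `X(ν)` carries a proposal** (a READY one, or a non-ready one with a prep centre through one of
its points). [folklore] -/
theorem StrategyE.surfacePhase_exists_step_iff {W : Scheme.{u}} {hW : IsLocallyNoetherian W} {L : Labelling W} {P : Option (Pending W)}
    {E : Boundary W} :
    (∃ (C : W.IdealSheafData) (P' : Option (Pending (blowup C))), (StrategyE.surfacePhase Ready prep).step W hW N ν L P E C P') ↔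
      ∃ (D : Closeds W), (D : Set W) ∈ surfaceComponents W N ν ∧
        (Ready W E N ν D ∨ ∃ (x : W) (C : W.IdealSheafData), x ∈ (D : Set W) ∧ prep W hW N ν L P E D C ∧ x ∈ (C.support : Set W)) := by
  rw [StrategyE.surfacePhase_eq, StrategyE.oldestFirst_exists_step_iff]
  constructor
  · rintro ⟨x, ⟨-, C, P', D, hD, hxD, -, h⟩, -⟩
    rcases h with ⟨hR, -⟩ | ⟨hR, hprep, hxC⟩
    · exact ⟨D, hD, Or.inl hR⟩
    · exact ⟨D, hD, Or.inr ⟨x, C, hxD, hprep, hxC⟩⟩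
  · rintro ⟨D, hD, h⟩
    apply HasLiveSite.hasOldestLiveSite
    by_cases hR : Ready W E N ν D
    · obtain ⟨x, hx⟩ := (componentsIn.nonempty hD.1 : (D : Set W).Nonempty)
      exact ⟨x, subset_hsStratum_of_mem_surfaceComponents hD hx, menuCentre D, none, D, hD, hx, rfl, Or.inl ⟨hR, rfl⟩⟩
    · rcases h with hR' | ⟨x, C, hxD, hprep, hxC⟩
      · exact absurd hR' hR
      · exact ⟨x, subset_hsStratum_of_mem_surfaceComponents hD hxD, C, none, D, hD, hxD, rfl, Or.inr ⟨hR, hprep, hxC⟩⟩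

/-- **THE (P1) TIER IS STRATUM-DISCIPLINED** as soon as readiness entails regularity of the surface as a subscheme (it is meant to entail more: n.c. with
the boundary) and prep centres are regular and inside `X(ν)` (PHASE S / B′ centres lie in `Sing D ⊆ D ⊆ X(ν)`, res-type-001's closure lemmas).
[folklore] -/
theorem StrategyE.surfacePhase_isStratumDisciplined
    (hReady : ∀ (W : Scheme.{u}) (E : Boundary W) (D : Closeds W), (D : Set W) ∈ surfaceComponents W N ν → Ready W E N ν D →
      Scheme.IsRegular (menuCentre D).subscheme)
    (hprep : ∀ (W : Scheme.{u}) (hW : IsLocallyNoetherian W) (L : Labelling W) (P : Option (Pending W)) (E : Boundary W) (D : Closeds W)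
      (C : W.IdealSheafData), (D : Set W) ∈ surfaceComponents W N ν → prep W hW N ν L P E D C →
        Scheme.IsRegular C.subscheme ∧ (C.support : Set W) ⊆ Scheme.hsStratum W N ν) :
    (StrategyE.surfacePhase Ready prep).IsStratumDisciplined N ν := by
  refine StrategyE.oldestFirst_isDisciplinedBy fun W hW L P E x C P' _ hρ => ?_
  obtain ⟨D, hD, hxD, -, h⟩ := hρ
  rcases h with ⟨hR, rfl⟩ | ⟨-, hp, hxC⟩
  · exact stratumMenu_of_subset (hReady W E D hD hR) (by simpa using hxD)
      (by simpa using subset_hsStratum_of_mem_surfaceComponents hD)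
  · obtain ⟨hreg, hsub⟩ := hprep W hW L P E D C hD hp
    exact stratumMenu_of_subset hreg hxC hsub

end Surface

/-! ## §2. The assembly of record: the three-tier policy and its hybrid over the CJS fallback -/

section Policy

variable {M : CentreMenu.{u}} {N : ℕ} {ν : ℕ → ℕ} {π₁ π₂ π₃ τ : StrategyE.{u}} {𝒮 : StateScopeE.{u}} {W : Scheme.{u}}
  {hW : IsLocallyNoetherian W} {L : Labelling W} {P : Option (Pending W)} {E : Boundary W}

/-- **Nesting is associative, step-wise**: `(π₁ ▹ π₂) ▹ π₃` and `π₁ ▹ (π₂ ▹ π₃)` allow the same steps. [folklore] -/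
theorem StrategyE.hybrid_assoc_step_iff {C : W.IdealSheafData} {P' : Option (Pending (blowup C))} :
    ((π₁.hybrid π₂).hybrid π₃).step W hW N ν L P E C P' ↔ (π₁.hybrid (π₂.hybrid π₃)).step W hW N ν L P E C P' := by
  have hne : (¬ ∃ (C₀ : W.IdealSheafData) (P₀ : Option (Pending (blowup C₀))), (π₁.hybrid π₂).step W hW N ν L P E C₀ P₀) ↔
      (¬ ∃ (C₀ : W.IdealSheafData) (P₀ : Option (Pending (blowup C₀))), π₁.step W hW N ν L P E C₀ P₀) ∧
        ¬ ∃ (C₀ : W.IdealSheafData) (P₀ : Option (Pending (blowup C₀))), π₂.step W hW N ν L P E C₀ P₀ := by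
    rw [StrategyE.hybrid_exists_step_iff, not_or]
  constructor
  · rintro (h | ⟨hn, h₃⟩)
    · rcases h with h₁ | ⟨hn₁, h₂⟩
      · exact Or.inl h₁
      · exact Or.inr ⟨hn₁, Or.inl h₂⟩
    · obtain ⟨hn₁, hn₂⟩ := hne.mp hn
      exact Or.inr ⟨hn₁, Or.inr ⟨hn₂, h₃⟩⟩
  · rintro (h₁ | ⟨hn₁, h₂ | ⟨hn₂, h₃⟩⟩)
    · exact Or.inl (Or.inl h₁)
    · exact Or.inl (Or.inr ⟨hn₁, h₂⟩)
    · exact Or.inr ⟨hne.mpr ⟨hn₁, hn₂⟩, h₃⟩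

/-- [OURS · L1 W4.2] **THE POLICY OF RECORD (the three designed tiers, WITHOUT the fallback)**: `π₁ ▹ (π₂ ▹ π₃)` — (P1) surfaces > (P2) oldest group >
(P2′) oldest partial-frame site. Its hybrid over the CJS fallback is LITERALLY of the shape `π.hybrid (ofStageOracleE ω)` that `HybridEliminationHyp3S`
asks for, and step-equivalent to `StrategyE.tiered π₁ π₂ π₃ τ`. NOT a statement of the manuscript. [folklore] -/
def StrategyE.policyOfRecord (π₁ π₂ π₃ : StrategyE.{u}) : StrategyE.{u} :=
  π₁.hybrid (π₂.hybrid π₃)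

/-- Unfolding (`rfl`). [folklore] -/
theorem StrategyE.policyOfRecord_eq (π₁ π₂ π₃ : StrategyE.{u}) : StrategyE.policyOfRecord π₁ π₂ π₃ = π₁.hybrid (π₂.hybrid π₃) :=
  rfl

/-- Congruence of the hybrid in its fallback, step-wise (the silence clause only reads the policy). [folklore] -/
theorem StrategyE.hybrid_step_congr_right {π X Y : StrategyE.{u}} {C : W.IdealSheafData} {P' : Option (Pending (blowup C))}
    (h : X.step W hW N ν L P E C P' ↔ Y.step W hW N ν L P E C P') :
    (π.hybrid X).step W hW N ν L P E C P' ↔ (π.hybrid Y).step W hW N ν L P E C P' :=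
  or_congr Iff.rfl (and_congr Iff.rfl h)

/-- **`(policyOfRecord π₁ π₂ π₃).hybrid τ` and `tiered π₁ π₂ π₃ τ` allow the same steps** (associativity, twice). [folklore] -/
theorem StrategyE.policyOfRecord_hybrid_step_iff_tiered {C : W.IdealSheafData} {P' : Option (Pending (blowup C))} :
    ((StrategyE.policyOfRecord π₁ π₂ π₃).hybrid τ).step W hW N ν L P E C P' ↔ (StrategyE.tiered π₁ π₂ π₃ τ).step W hW N ν L P E C P' :=
  StrategyE.hybrid_assoc_step_iff.trans (StrategyE.hybrid_step_congr_right StrategyE.hybrid_assoc_step_iff)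

/-- **The policy of record is FUNCTIONAL when its tiers are.** [folklore] -/
theorem StrategyE.IsFunctional.policyOfRecord (h₁ : π₁.IsFunctional N ν) (h₂ : π₂.IsFunctional N ν) (h₃ : π₃.IsFunctional N ν) :
    (StrategyE.policyOfRecord π₁ π₂ π₃).IsFunctional N ν :=
  h₁.hybrid (h₂.hybrid h₃)

/-- **The policy of record is `M`-DISCIPLINED when its tiers are** (menu-generic). [folklore] -/
theorem StrategyE.IsDisciplinedBy.policyOfRecord (h₁ : π₁.IsDisciplinedBy M N ν) (h₂ : π₂.IsDisciplinedBy M N ν) (h₃ : π₃.IsDisciplinedBy M N ν) :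
    (StrategyE.policyOfRecord π₁ π₂ π₃).IsDisciplinedBy M N ν :=
  h₁.hybrid₂ (h₂.hybrid₂ h₃)

/-- **The policy of record is STRATUM-DISCIPLINED when its tiers are** — the discipline `HybridEliminationHyp3S` asks for (a Plus-disciplined tier enters
through `IsMenuDisciplined.toStratum`). [folklore] -/
theorem StrategyE.IsStratumDisciplined.policyOfRecord (h₁ : π₁.IsStratumDisciplined N ν) (h₂ : π₂.IsStratumDisciplined N ν)
    (h₃ : π₃.IsStratumDisciplined N ν) : (StrategyE.policyOfRecord π₁ π₂ π₃).IsStratumDisciplined N ν :=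
  StrategyE.IsDisciplinedBy.policyOfRecord h₁ h₂ h₃

/-- The hybrid of the stratum-disciplined policy of record over the CJS fallback steps only while the stratum is non-empty. [folklore] -/
theorem StrategyE.IsStratumDisciplined.policyOfRecord_stepsOnlyWhileNonempty_hybrid_ofStageOracleE (h₁ : π₁.IsStratumDisciplined N ν)
    (h₂ : π₂.IsStratumDisciplined N ν) (h₃ : π₃.IsStratumDisciplined N ν) (ω : StageOracleE.{u}) :
    ((StrategyE.policyOfRecord π₁ π₂ π₃).hybrid (StrategyE.ofStageOracleE ω)).StepsOnlyWhileNonempty N ν :=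
  (h₁.policyOfRecord h₂ h₃).stepsOnlyWhileNonempty_hybrid_ofStageOracleE ω

/-- **SCOPED ADMISSIBILITY OF THE ASSEMBLED HYBRID**: three stratum-disciplined tiers, a fallback with clause (a) and totality on a GOOD scope,
`ν ≠ Φ^{(N)}` ⇒ `IsAdmissibleStrategyOnE 𝒮 N ν ((policyOfRecord π₁ π₂ π₃).hybrid τ)`. [cite: CossartJannsenSaito2020, Def. 3.1, Rem. 6.29 (1)] -/
theorem isAdmissibleStrategyOnE_policyOfRecord_hybrid (h₁ : π₁.IsStratumDisciplined N ν) (h₂ : π₂.IsStratumDisciplined N ν)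
    (h₃ : π₃.IsStratumDisciplined N ν) (h𝒮 : StateScopeGood N ν 𝒮) (hν : ν ≠ iterPSum N Phi)
    (hτa : ∀ (W : Scheme.{u}) (hW : IsLocallyNoetherian W) (L : Labelling W) (P : Option (Pending W)) (E : Boundary W), 𝒮 W hW L P E →
      ∀ (C : W.IdealSheafData) (P' : Option (Pending (blowup C))), τ.step W hW N ν L P E C P' →
        IdealSheafData.IsPermissible C ∧ (C.support : Set W) ⊆ Scheme.hsStratum W N ν ∧
          ((Scheme.hsStratum W N ν).Nonempty → (C.support : Set W).Nonempty))
    (hτt : ∀ (W : Scheme.{u}) (hW : IsLocallyNoetherian W) (L : Labelling W) (P : Option (Pending W)) (E : Boundary W), 𝒮 W hW L P E →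
      (Scheme.hsStratum W N ν).Nonempty → ∃ (C : W.IdealSheafData) (P' : Option (Pending (blowup C))), τ.step W hW N ν L P E C P') :
    IsAdmissibleStrategyOnE 𝒮 N ν ((StrategyE.policyOfRecord π₁ π₂ π₃).hybrid τ) :=
  isAdmissibleStrategyOnE_hybrid_stratum (h₁.policyOfRecord h₂ h₃) h𝒮 hν hτa hτt

/-- **STRATUM-disciplined tiers give a scheduler stratum-disciplined over its fallback** (the named sugar deferred from `…SigmaMenuTiers`). [folklore] -/
theorem StrategyE.IsStratumDisciplined.tiered (h₁ : π₁.IsStratumDisciplined N ν) (h₂ : π₂.IsStratumDisciplined N ν)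
    (h₃ : π₃.IsStratumDisciplined N ν) (τ : StrategyE.{u}) : StrategyE.IsStratumDisciplinedOver N ν τ (StrategyE.tiered π₁ π₂ π₃ τ) :=
  StrategyE.IsDisciplinedBy.tiered h₁ h₂ h₃ τ

/-- **SCOPED ADMISSIBILITY OF THE STRATUM-DISCIPLINED TIERED SCHEDULER ON GOOD SCOPES** (`ν ≠ Φ^{(N)}`; clause (a) by `menuClauseA_stratum`).
[cite: CossartJannsenSaito2020, Def. 3.1, Rem. 6.29 (1)] -/
theorem isAdmissibleStrategyOnE_tiered_stratum (h₁ : π₁.IsStratumDisciplined N ν) (h₂ : π₂.IsStratumDisciplined N ν)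
    (h₃ : π₃.IsStratumDisciplined N ν) (h𝒮 : StateScopeGood N ν 𝒮) (hν : ν ≠ iterPSum N Phi)
    (hτa : ∀ (W : Scheme.{u}) (hW : IsLocallyNoetherian W) (L : Labelling W) (P : Option (Pending W)) (E : Boundary W), 𝒮 W hW L P E →
      ∀ (C : W.IdealSheafData) (P' : Option (Pending (blowup C))), τ.step W hW N ν L P E C P' →
        IdealSheafData.IsPermissible C ∧ (C.support : Set W) ⊆ Scheme.hsStratum W N ν ∧
          ((Scheme.hsStratum W N ν).Nonempty → (C.support : Set W).Nonempty))
    (hτt : ∀ (W : Scheme.{u}) (hW : IsLocallyNoetherian W) (L : Labelling W) (P : Option (Pending W)) (E : Boundary W), 𝒮 W hW L P E →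
      (Scheme.hsStratum W N ν).Nonempty → ∃ (C : W.IdealSheafData) (P' : Option (Pending (blowup C))), τ.step W hW N ν L P E C P') :
    IsAdmissibleStrategyOnE 𝒮 N ν (StrategyE.tiered π₁ π₂ π₃ τ) :=
  isAdmissibleStrategyOnE_tiered h₁ h₂ h₃ (menuClauseA_stratum h𝒮 hν) hτa hτt

end Policy

end Summit.ResolutionOfSingularities.ResolutionOfSingularities.Theorems.SigmaMaxModificationsCorridor3.Sigma

end
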